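/-
Copyright: b2b-lace packet (LEAN TYPING SEAT 1 gen 37, node K0-FAR-UNIFORM-D10: the m-UNIFORM far axis rows of
the column `K_{N,0}` at `d := 10`, `|m| ≥ 6`, `N = 1, 2, 3`, by the literal-input `J = 0` device of
`SrwTwistMUniformLitBound` at the six abscissae of the certified trigonometric majorant `gset`).
What-if / input-certification lane at `d := 10`; nothing here is a certificate of record.
-/
import Literature.Probability.FitznerVanDerHofstad2017.SrwTwistMUniformLitBound
import Literature.Probability.FitznerVanDerHofstad2017.SrwTrigMajorantEncl
import Literature.Probability.FitznerVanDerHofstad2017.SrwRegionSplitAxisCells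
import Literature.Probability.FitznerVanDerHofstad2017.SrwIntegralMonotone
import Literature.Probability.FitznerVanDerHofstad2017.SrwITableD10Origin
import Literature.Probability.FitznerVanDerHofstad2017.SrwSeedEnclD10ClassesX
import Literature.Probability.FitznerVanDerHofstad2017.SrwSeedEnclD10ClassesY
import Literature.Analysis.FunctionSpaces.BesselJLiteralCertTable
import Literature.Analysis.FunctionSpaces.BesselJOrderTailGeometric
import Literature.Analysis.FunctionSpaces.BesselJAlternatingBound
import HarnessLib

/-!
# `K_{N,0}(m e_i; 10)` for EVERY `|m| ≥ 6` at once (`N = 1, 2, 3`): the m-uniform far axis rows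

CITATION HEADER (PLACEMENT v2). Part of the certified REPRODUCTION of the numerical inputs of
R. Fitzner, R. van der Hofstad, *Generalized approach to the non-backtracking lace expansion*,
Probab. Theory Related Fields 169 (2017) 1041–1119 [NoBLE17-I] (arXiv:1506.07969): the SRW Fourier
integrals `I_{n,l}` (5.1) p. 1090 and `K_{n,l}(x) = ∫ D̂^l Ĉ^n cos(k·x)` (5.15) p. 1092, evaluated through
Bessel rows §5.1.1 (5.2)–(5.5) pp. 1089–1090 (the notebook `SRW.nb`); Bessel facts from NIST DLMF §10.2.2,
§10.14.4 [DLMF].  Nothing in this file is a claim of the paper beyond those formulas; everything below is PROVED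
(standard axioms) from landed tree modules.

## What this module adds

The cell theorems of `SrwKZeroAxisCellsD10` bound `K_{N,0}(m e_i; 10)` at the single nodes `m = 1, …, 5`.  This
module bounds the WHOLE far axis `|m| ≥ 6` by ONE literal per `N`:

* `FarRowD10.srwK_zero_far_d10_n1 / _n2 / _n3`:
  `6 ≤ |m| → K_{N,0}(m e_i; 10) ≤ A_N` for every axis `i`, with
  `A_1 = 194492 / 10⁶`, `A_2 = 221423 / 10⁶`, `A_3 = 286086 / 10⁶` (the literal right-hand sides of the three theorems).

Route (all ingredients landed, by name).  `SrwTrigMajorantEncl.srwK_zero_single_le_uniform_gset_cast` bounds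
`K_{N,0}(m e_i)` for all `|m| ≥ M` from the origin enclosure `I_{N,0}(0) ∈ [Tlo, Thi]` (`SrwITableD10Origin`),
two plain seeds `I_{N,0}(2M e_i)`, `I_{N,0}(M e_i + M e_j)` and, at the six abscissae `β_r = 5r + 5` of the
certified majorant `gset`, bounds `|Tw_N(m e_i; β_r) − Q_r · I_{N,0}(0)| ≤ E_r`.  The latter are supplied here
UNIFORMLY in `|m| ≥ 6` by the literal-input `J = 0` device
`SrwTwistMUniformLitBound.abs_srwTwist_sub_lit_pow_mul_srwI_le_of_lit_main_cast` (`M = 6`, `Q_r = q_r^{10}`):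
its scalar inputs are `q_r = Q₀/10²⁴` and `e = 10⁻²⁴` from the decided 24-digit Bessel literal tables
`JLit.jlitY05 … jlitY30` (`BesselJLiteralCertTable`, `y_r = β_r/10 = 1/2, …, 3`), the order-tail bound
`Σ_{l≥0} |J_{l+1}(y_r)| ≤ besselTailQ y_r Q` (§1: the first sixteen orders from the same tables, the rest by
`BesselJOrderTailGeometric.tsum_abs_besselJ_orderTail_le_sum_add_geom` with `J = 1`, `K = 15`, valid for
`y² ≤ 12`), and the two-level seeds `I_{N,0}(6(e_0+…+e_k))` bounded through `absMonotone_srwI`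
(`SrwIntegralMonotone`) by the decided SEEDCERT classes `[6]` (`k = 0`), `[1,6]` (`k = 1, 2`), `[1,1,6,6]`
(`k ≥ 3`) of `SrwSeedEnclD10ClassesX/Y`; the same classes bound the two plain seeds (`12 e_0` by `[6]`,
`6e_0 + 6e_1` by `[1,6]`).  The device error terms `farEB05 N, …, farEB30 N` are CLOSED RATIONAL TERMS
(`litBoundQ` at the named scalars; no decimal value is asserted for them); the three row literals `A_N` are
certified against the assembled rational bound by `decide +kernel`.

This is an INPUT-CERTIFICATION module: it fixes `d = 10` only inside namespace `FarRowD10`, asserts nothing about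
any bootstrap and instantiates no `…Of` certificate.  Epistemic status / lane: what-if / input-certification at
`d := 10`; nothing here is a certificate of record; no dimension sentence.

## References
* R. Fitzner, R. van der Hofstad, *Generalized approach to the non-backtracking lace expansion*,
  Probab. Theory Related Fields 169 (2017) 1041–1119, §5.1 pp. 1089–1093. [FitznerVanDerHofstad2016NoBLE]
* NIST Digital Library of Mathematical Functions, §10.2.2, §10.14.4. [DLMF]
-/

namespace Literature.Probability.FitznerVanDerHofstad2017

open _root_.MeasureTheory Finset
open scoped BigOperators Nat
open Literature.Analysis.FunctionSpaces (besselJ tsum_abs_besselJ_orderTail_le_sum_add_geom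
  summable_abs_besselJ_orderTail_of_sq_le)
open Literature.Analysis.FunctionSpaces.JLit
open TrigEncl SeedCert

namespace FarRowD10

/-! ### §1. The Bessel order tail `Σ_{l≥0} |J_{l+1}(y)|` from a 24-digit literal table -/

/-- The rational order-tail bound read from a 24-digit literal table `Q` of `J_j(y)`, `j < 17`:
`(|Q 1|+1)/10²⁴ + Σ_{l<15} (|Q (l+2)|+1)/10²⁴ + (y/2)¹⁷/17! · 18/(18 − y/2)`. [cite: DLMF, §10.14.4] -/
def besselTailQ (Y : ℚ) (Q : ℕ → ℤ) : ℚ :=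
  (((|Q 1| : ℤ) : ℚ) / 10 ^ 24 + 1 / 10 ^ 24)
    + ((∑ l ∈ Finset.range 15, ((((|Q (l + 1 + 1)| : ℤ) : ℚ) / 10 ^ 24 + 1 / 10 ^ 24)))
      + (Y / 2) ^ 17 / ((17)! : ℚ) * 18 / (18 - Y / 2))

/-- **`Σ_{l≥0} |J_{l+1}(y)| ≤ besselTailQ y Q`** for `0 ≤ y`, `y² ≤ 12` and a table with `|Q_j/10²⁴ − J_j(y)| ≤ 10⁻²⁴`
(`j < 17`): split off `|J_1|`, bound the orders `2 … 16` by the table and the rest geometrically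
(`tsum_abs_besselJ_orderTail_le_sum_add_geom`, `J = 1`, `K = 15`). [cite: DLMF, §10.14.4] -/
theorem tsum_abs_besselJ_succ_le_besselTailQ {Y : ℚ} (hY0 : 0 ≤ Y) (hY : Y ^ 2 ≤ 12) {Q : ℕ → ℤ}
    (htab : ∀ j : ℕ, j < 17 → |((Q j : ℤ) : ℝ) / (10 ^ 24 : ℝ) - besselJ j ((Y : ℚ) : ℝ)| ≤ 1 / 10 ^ 24) :
    ∑' l : ℕ, |besselJ (l + 1) ((Y : ℚ) : ℝ)| ≤ ((besselTailQ Y Q : ℚ) : ℝ) := by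
  have hy0 : (0 : ℝ) ≤ ((Y : ℚ) : ℝ) := by exact_mod_cast hY0
  have h12 : ((Y : ℚ) : ℝ) ^ 2 ≤ 4 * ((1 : ℕ) + 2 : ℝ) := by
    have h : ((Y : ℚ) : ℝ) ^ 2 ≤ 12 := by exact_mod_cast hY
    push_cast
    linarith
  have hs2 : Summable fun l : ℕ => |besselJ (l + 1 + 1) ((Y : ℚ) : ℝ)| :=
    summable_abs_besselJ_orderTail_of_sq_le 1 h12
  have htail := tsum_abs_besselJ_orderTail_le_sum_add_geom 1 15 h12
  have hj : ∀ j, j < 17 → |besselJ j ((Y : ℚ) : ℝ)| ≤ ((|Q j| : ℤ) : ℝ) / 10 ^ 24 + 1 / 10 ^ 24 := by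
    intro j hj
    have h := htab j hj
    have h1 : |besselJ j ((Y : ℚ) : ℝ)| ≤ |((Q j : ℤ) : ℝ) / (10 ^ 24 : ℝ)| + 1 / 10 ^ 24 := by
      have h2 := abs_sub_abs_le_abs_sub (besselJ j ((Y : ℚ) : ℝ)) (((Q j : ℤ) : ℝ) / (10 ^ 24 : ℝ))
      rw [abs_sub_comm] at h
      linarith
    rw [abs_div, abs_of_pos (by positivity : (0 : ℝ) < 10 ^ 24), ← Int.cast_abs] at h1
    exact h1
  rw [show (∑' l : ℕ, |besselJ (l + 1) ((Y : ℚ) : ℝ)|)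
      = |besselJ (0 + 1) ((Y : ℚ) : ℝ)| + ∑' l : ℕ, |besselJ (l + 1 + 1) ((Y : ℚ) : ℝ)|
      from tsum_eq_zero_add' hs2]
  have htl : |((Y : ℚ) : ℝ) / 2| ^ (1 + 15 + 1) / ((1 + 15 + 1)! : ℝ) * (((1 + 15 : ℕ) : ℝ) + 2)
        / ((((1 + 15 : ℕ) : ℝ) + 2) - |((Y : ℚ) : ℝ) / 2|)
      = (((Y : ℚ) : ℝ) / 2) ^ 17 / ((17)! : ℝ) * 18 / (18 - ((Y : ℚ) : ℝ) / 2) := by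
    rw [abs_of_nonneg (by linarith : (0 : ℝ) ≤ ((Y : ℚ) : ℝ) / 2)]
    norm_num
  calc |besselJ (0 + 1) ((Y : ℚ) : ℝ)| + ∑' l : ℕ, |besselJ (l + 1 + 1) ((Y : ℚ) : ℝ)|
      ≤ (((|Q 1| : ℤ) : ℝ) / 10 ^ 24 + 1 / 10 ^ 24)
        + ((∑ l ∈ Finset.range 15, ((((|Q (l + 1 + 1)| : ℤ) : ℝ) / 10 ^ 24 + 1 / 10 ^ 24)))
          + (((Y : ℚ) : ℝ) / 2) ^ 17 / ((17)! : ℝ) * 18 / (18 - ((Y : ℚ) : ℝ) / 2)) :=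
        add_le_add (hj 1 (by norm_num)) (htail.trans (add_le_add
          (Finset.sum_le_sum fun l hl => hj _ (by rw [Finset.mem_range] at hl; omega)) htl.le))
    _ = ((besselTailQ Y Q : ℚ) : ℝ) := by
        simp only [besselTailQ]
        push_cast
        ring

/-! ### §2. The rational device bound and the scalar inputs at `d := 10` -/

/-- The right-hand side of `abs_srwTwist_sub_lit_pow_mul_srwI_le_of_lit_main_cast` as a rational function of its
scalar inputs (verbatim). [cite: FitznerVanDerHofstad2016NoBLE, §5.1.1 (5.2)–(5.5) pp. 1089–1090] -/
def litBoundQ (d : ℕ) (q e δb T : ℚ) (I : ℕ → ℚ) : ℚ :=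
  (∑ k ∈ Finset.range d, (d.choose (k + 1) : ℚ) * (|q| + e) ^ (d - (k + 1))
      * (2 * δb) ^ (k + 1) * I k) + d * e * (|q| + e) ^ (d - 1) * T

/-- `q = Q₀/10²⁴`, the 24-digit literal of `J_0(1 / 2)` (`JLit.jlitY05`). [cite: DLMF, §10.2.2] -/
def qB05 : ℚ := (jlitY05.Q 0 : ℚ) / 10 ^ 24

/-- The order-tail bound at `y = 1 / 2` from the table `JLit.jlitY05`. [cite: DLMF, §10.14.4] -/
def deltaB05 : ℚ := besselTailQ (1 / 2) jlitY05.Q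

/-- `q = Q₀/10²⁴`, the 24-digit literal of `J_0(1)` (`JLit.jlitY10`). [cite: DLMF, §10.2.2] -/
def qB10 : ℚ := (jlitY10.Q 0 : ℚ) / 10 ^ 24

/-- The order-tail bound at `y = 1` from the table `JLit.jlitY10`. [cite: DLMF, §10.14.4] -/
def deltaB10 : ℚ := besselTailQ (1) jlitY10.Q

/-- `q = Q₀/10²⁴`, the 24-digit literal of `J_0(3 / 2)` (`JLit.jlitY15`). [cite: DLMF, §10.2.2] -/
def qB15 : ℚ := (jlitY15.Q 0 : ℚ) / 10 ^ 24

/-- The order-tail bound at `y = 3 / 2` from the table `JLit.jlitY15`. [cite: DLMF, §10.14.4] -/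
def deltaB15 : ℚ := besselTailQ (3 / 2) jlitY15.Q

/-- `q = Q₀/10²⁴`, the 24-digit literal of `J_0(2)` (`JLit.jlitY20`). [cite: DLMF, §10.2.2] -/
def qB20 : ℚ := (jlitY20.Q 0 : ℚ) / 10 ^ 24

/-- The order-tail bound at `y = 2` from the table `JLit.jlitY20`. [cite: DLMF, §10.14.4] -/
def deltaB20 : ℚ := besselTailQ (2) jlitY20.Q

/-- `q = Q₀/10²⁴`, the 24-digit literal of `J_0(5 / 2)` (`JLit.jlitY25`). [cite: DLMF, §10.2.2] -/
def qB25 : ℚ := (jlitY25.Q 0 : ℚ) / 10 ^ 24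

/-- The order-tail bound at `y = 5 / 2` from the table `JLit.jlitY25`. [cite: DLMF, §10.14.4] -/
def deltaB25 : ℚ := besselTailQ (5 / 2) jlitY25.Q

/-- `q = Q₀/10²⁴`, the 24-digit literal of `J_0(3)` (`JLit.jlitY30`). [cite: DLMF, §10.2.2] -/
def qB30 : ℚ := (jlitY30.Q 0 : ℚ) / 10 ^ 24

/-- The order-tail bound at `y = 3` from the table `JLit.jlitY30`. [cite: DLMF, §10.14.4] -/
def deltaB30 : ℚ := besselTailQ (3) jlitY30.Q

/-- The two-level seed table at `M = 6`: `I_{N,0}(6(e_0+…+e_k); 10) ≤ farI N k`, the decided class ceilings of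
`[6]` (`k = 0`), `[1,6]` (`k = 1, 2`), `[1,1,6,6]` (`k ≥ 3`). [cite: FitznerVanDerHofstad2016NoBLE, (5.1) p. 1090] -/
def farI : ℕ → ℕ → ℚ
  | N, 0 => cert_d10_v000001.hi N
  | N, 1 => cert_d10_v100001.hi N
  | N, 2 => cert_d10_v100001.hi N
  | N, _ + 3 => cert_d10_v200002.hi N

/-- The device error at `β = 5` (`y = 1 / 2`), `M = 6`, order `N`: a closed rational term. [cite: FitznerVanDerHofstad2016NoBLE, §5.1.1 (5.2)–(5.5) pp. 1089–1090] -/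
def farEB05 (N : ℕ) : ℚ := litBoundQ 10 qB05 (1 / 10 ^ 24) deltaB05 (ITableD10.tabHi N 0) (farI N)

/-- The device error at `β = 10` (`y = 1`), `M = 6`, order `N`: a closed rational term. [cite: FitznerVanDerHofstad2016NoBLE, §5.1.1 (5.2)–(5.5) pp. 1089–1090] -/
def farEB10 (N : ℕ) : ℚ := litBoundQ 10 qB10 (1 / 10 ^ 24) deltaB10 (ITableD10.tabHi N 0) (farI N)

/-- The device error at `β = 15` (`y = 3 / 2`), `M = 6`, order `N`: a closed rational term. [cite: FitznerVanDerHofstad2016NoBLE, §5.1.1 (5.2)–(5.5) pp. 1089–1090] -/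
def farEB15 (N : ℕ) : ℚ := litBoundQ 10 qB15 (1 / 10 ^ 24) deltaB15 (ITableD10.tabHi N 0) (farI N)

/-- The device error at `β = 20` (`y = 2`), `M = 6`, order `N`: a closed rational term. [cite: FitznerVanDerHofstad2016NoBLE, §5.1.1 (5.2)–(5.5) pp. 1089–1090] -/
def farEB20 (N : ℕ) : ℚ := litBoundQ 10 qB20 (1 / 10 ^ 24) deltaB20 (ITableD10.tabHi N 0) (farI N)

/-- The device error at `β = 25` (`y = 5 / 2`), `M = 6`, order `N`: a closed rational term. [cite: FitznerVanDerHofstad2016NoBLE, §5.1.1 (5.2)–(5.5) pp. 1089–1090] -/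
def farEB25 (N : ℕ) : ℚ := litBoundQ 10 qB25 (1 / 10 ^ 24) deltaB25 (ITableD10.tabHi N 0) (farI N)

/-- The device error at `β = 30` (`y = 3`), `M = 6`, order `N`: a closed rational term. [cite: FitznerVanDerHofstad2016NoBLE, §5.1.1 (5.2)–(5.5) pp. 1089–1090] -/
def farEB30 (N : ℕ) : ℚ := litBoundQ 10 qB30 (1 / 10 ^ 24) deltaB30 (ITableD10.tabHi N 0) (farI N)

/-! ### §3. The scalar hypotheses of the device -/

/-- `|q − J_0(5/10)| ≤ 10⁻²⁴` in the device's shape. [cite: DLMF, §10.2.2] -/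
private theorem hq_b05 :
    |((qB05 : ℚ) : ℝ) - besselJ 0 ((5 : ℝ) / ((10 : ℕ) : ℝ))| ≤ (((1 / 10 ^ 24 : ℚ)) : ℝ) := by
  have h := abs_jlitY05_sub_besselJ_le_of_eq (x := (5 : ℝ) / ((10 : ℕ) : ℝ)) (by norm_num) (j := 0) (by norm_num)
  have e1 : ((qB05 : ℚ) : ℝ) = ((jlitY05.Q 0 : ℤ) : ℝ) / (10 ^ 24 : ℝ) := by
    norm_num [qB05]
  have e2 : (((1 / 10 ^ 24 : ℚ)) : ℝ) = 1 / 10 ^ 24 := by norm_num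
  rw [e1, e2]
  exact h

/-- `|q − J_0(10/10)| ≤ 10⁻²⁴` in the device's shape. [cite: DLMF, §10.2.2] -/
private theorem hq_b10 :
    |((qB10 : ℚ) : ℝ) - besselJ 0 ((10 : ℝ) / ((10 : ℕ) : ℝ))| ≤ (((1 / 10 ^ 24 : ℚ)) : ℝ) := by
  have h := abs_jlitY10_sub_besselJ_le_of_eq (x := (10 : ℝ) / ((10 : ℕ) : ℝ)) (by norm_num) (j := 0) (by norm_num)
  have e1 : ((qB10 : ℚ) : ℝ) = ((jlitY10.Q 0 : ℤ) : ℝ) / (10 ^ 24 : ℝ) := by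
    norm_num [qB10]
  have e2 : (((1 / 10 ^ 24 : ℚ)) : ℝ) = 1 / 10 ^ 24 := by norm_num
  rw [e1, e2]
  exact h

/-- `|q − J_0(15/10)| ≤ 10⁻²⁴` in the device's shape. [cite: DLMF, §10.2.2] -/
private theorem hq_b15 :
    |((qB15 : ℚ) : ℝ) - besselJ 0 ((15 : ℝ) / ((10 : ℕ) : ℝ))| ≤ (((1 / 10 ^ 24 : ℚ)) : ℝ) := by
  have h := abs_jlitY15_sub_besselJ_le_of_eq (x := (15 : ℝ) / ((10 : ℕ) : ℝ)) (by norm_num) (j := 0) (by norm_num)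
  have e1 : ((qB15 : ℚ) : ℝ) = ((jlitY15.Q 0 : ℤ) : ℝ) / (10 ^ 24 : ℝ) := by
    norm_num [qB15]
  have e2 : (((1 / 10 ^ 24 : ℚ)) : ℝ) = 1 / 10 ^ 24 := by norm_num
  rw [e1, e2]
  exact h

/-- `|q − J_0(20/10)| ≤ 10⁻²⁴` in the device's shape. [cite: DLMF, §10.2.2] -/
private theorem hq_b20 :
    |((qB20 : ℚ) : ℝ) - besselJ 0 ((20 : ℝ) / ((10 : ℕ) : ℝ))| ≤ (((1 / 10 ^ 24 : ℚ)) : ℝ) := by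
  have h := abs_jlitY20_sub_besselJ_le_of_eq (x := (20 : ℝ) / ((10 : ℕ) : ℝ)) (by norm_num) (j := 0) (by norm_num)
  have e1 : ((qB20 : ℚ) : ℝ) = ((jlitY20.Q 0 : ℤ) : ℝ) / (10 ^ 24 : ℝ) := by
    norm_num [qB20]
  have e2 : (((1 / 10 ^ 24 : ℚ)) : ℝ) = 1 / 10 ^ 24 := by norm_num
  rw [e1, e2]
  exact h

/-- `|q − J_0(25/10)| ≤ 10⁻²⁴` in the device's shape. [cite: DLMF, §10.2.2] -/
private theorem hq_b25 :
    |((qB25 : ℚ) : ℝ) - besselJ 0 ((25 : ℝ) / ((10 : ℕ) : ℝ))| ≤ (((1 / 10 ^ 24 : ℚ)) : ℝ) := by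
  have h := abs_jlitY25_sub_besselJ_le_of_eq (x := (25 : ℝ) / ((10 : ℕ) : ℝ)) (by norm_num) (j := 0) (by norm_num)
  have e1 : ((qB25 : ℚ) : ℝ) = ((jlitY25.Q 0 : ℤ) : ℝ) / (10 ^ 24 : ℝ) := by
    norm_num [qB25]
  have e2 : (((1 / 10 ^ 24 : ℚ)) : ℝ) = 1 / 10 ^ 24 := by norm_num
  rw [e1, e2]
  exact h

/-- `|q − J_0(30/10)| ≤ 10⁻²⁴` in the device's shape. [cite: DLMF, §10.2.2] -/
private theorem hq_b30 :
    |((qB30 : ℚ) : ℝ) - besselJ 0 ((30 : ℝ) / ((10 : ℕ) : ℝ))| ≤ (((1 / 10 ^ 24 : ℚ)) : ℝ) := by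
  have h := abs_jlitY30_sub_besselJ_le_of_eq (x := (30 : ℝ) / ((10 : ℕ) : ℝ)) (by norm_num) (j := 0) (by norm_num)
  have e1 : ((qB30 : ℚ) : ℝ) = ((jlitY30.Q 0 : ℤ) : ℝ) / (10 ^ 24 : ℝ) := by
    norm_num [qB30]
  have e2 : (((1 / 10 ^ 24 : ℚ)) : ℝ) = 1 / 10 ^ 24 := by norm_num
  rw [e1, e2]
  exact h

/-- `Σ_{l≥0} |J_{l+1}(5/10)| ≤ deltaB05`. [cite: DLMF, §10.14.4] -/
private theorem hdelta_b05 :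
    ∑' l : ℕ, |besselJ (l + 1) ((5 : ℝ) / ((10 : ℕ) : ℝ))| ≤ ((deltaB05 : ℚ) : ℝ) := by
  have h := tsum_abs_besselJ_succ_le_besselTailQ (Y := 1 / 2) (by norm_num) (by norm_num)
    (Q := jlitY05.Q) (fun j hj => abs_jlitY05_sub_besselJ_le_of_eq (by norm_num) hj)
  have e : (((1 / 2 : ℚ)) : ℝ) = (5 : ℝ) / ((10 : ℕ) : ℝ) := by norm_num
  rw [e] at h
  exact h

/-- `Σ_{l≥0} |J_{l+1}(10/10)| ≤ deltaB10`. [cite: DLMF, §10.14.4] -/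
private theorem hdelta_b10 :
    ∑' l : ℕ, |besselJ (l + 1) ((10 : ℝ) / ((10 : ℕ) : ℝ))| ≤ ((deltaB10 : ℚ) : ℝ) := by
  have h := tsum_abs_besselJ_succ_le_besselTailQ (Y := 1) (by norm_num) (by norm_num)
    (Q := jlitY10.Q) (fun j hj => abs_jlitY10_sub_besselJ_le_of_eq (by norm_num) hj)
  have e : (((1 : ℚ)) : ℝ) = (10 : ℝ) / ((10 : ℕ) : ℝ) := by norm_num
  rw [e] at h
  exact h

/-- `Σ_{l≥0} |J_{l+1}(15/10)| ≤ deltaB15`. [cite: DLMF, §10.14.4] -/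
private theorem hdelta_b15 :
    ∑' l : ℕ, |besselJ (l + 1) ((15 : ℝ) / ((10 : ℕ) : ℝ))| ≤ ((deltaB15 : ℚ) : ℝ) := by
  have h := tsum_abs_besselJ_succ_le_besselTailQ (Y := 3 / 2) (by norm_num) (by norm_num)
    (Q := jlitY15.Q) (fun j hj => abs_jlitY15_sub_besselJ_le_of_eq (by norm_num) hj)
  have e : (((3 / 2 : ℚ)) : ℝ) = (15 : ℝ) / ((10 : ℕ) : ℝ) := by norm_num
  rw [e] at h
  exact h

/-- `Σ_{l≥0} |J_{l+1}(20/10)| ≤ deltaB20`. [cite: DLMF, §10.14.4] -/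
private theorem hdelta_b20 :
    ∑' l : ℕ, |besselJ (l + 1) ((20 : ℝ) / ((10 : ℕ) : ℝ))| ≤ ((deltaB20 : ℚ) : ℝ) := by
  have h := tsum_abs_besselJ_succ_le_besselTailQ (Y := 2) (by norm_num) (by norm_num)
    (Q := jlitY20.Q) (fun j hj => abs_jlitY20_sub_besselJ_le_of_eq (by norm_num) hj)
  have e : (((2 : ℚ)) : ℝ) = (20 : ℝ) / ((10 : ℕ) : ℝ) := by norm_num
  rw [e] at h
  exact h

/-- `Σ_{l≥0} |J_{l+1}(25/10)| ≤ deltaB25`. [cite: DLMF, §10.14.4] -/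
private theorem hdelta_b25 :
    ∑' l : ℕ, |besselJ (l + 1) ((25 : ℝ) / ((10 : ℕ) : ℝ))| ≤ ((deltaB25 : ℚ) : ℝ) := by
  have h := tsum_abs_besselJ_succ_le_besselTailQ (Y := 5 / 2) (by norm_num) (by norm_num)
    (Q := jlitY25.Q) (fun j hj => abs_jlitY25_sub_besselJ_le_of_eq (by norm_num) hj)
  have e : (((5 / 2 : ℚ)) : ℝ) = (25 : ℝ) / ((10 : ℕ) : ℝ) := by norm_num
  rw [e] at h
  exact h

/-- `Σ_{l≥0} |J_{l+1}(30/10)| ≤ deltaB30`. [cite: DLMF, §10.14.4] -/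
private theorem hdelta_b30 :
    ∑' l : ℕ, |besselJ (l + 1) ((30 : ℝ) / ((10 : ℕ) : ℝ))| ≤ ((deltaB30 : ℚ) : ℝ) := by
  have h := tsum_abs_besselJ_succ_le_besselTailQ (Y := 3) (by norm_num) (by norm_num)
    (Q := jlitY30.Q) (fun j hj => abs_jlitY30_sub_besselJ_le_of_eq (by norm_num) hj)
  have e : (((3 : ℚ)) : ℝ) = (30 : ℝ) / ((10 : ℕ) : ℝ) := by norm_num
  rw [e] at h
  exact h

/-- The two-level seeds at `M = 6`, order `1`: `I_{1,0}(6(e_0+…+e_k); 10) ≤ farI 1 k` by coordinatewise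
domination (`absMonotone_srwI`) from the decided classes `[6]`, `[1,6]`, `[1,1,6,6]`. [cite: FitznerVanDerHofstad2016NoBLE, (5.1) p. 1090] -/
private theorem hIk_n1 : ∀ k ∈ Finset.range 10,
    srwI 10 1 0 (fun μ : Fin 10 => if (μ : ℕ) < k + 1 then ((6 : ℕ) : ℤ) else 0) ≤ ((farI 1 k : ℚ) : ℝ) := by
  intro k hk
  rw [Finset.mem_range] at hk
  interval_cases k
  · exact (absMonotone_srwI (d := 10) (n := 1) (by norm_num) (by norm_num) 0 _ (clsPt 10 [6]) (by decide)).trans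
      (srwI_seed_encl_d10_v000001 1 (by norm_num) (by norm_num)).2
  · exact (absMonotone_srwI (d := 10) (n := 1) (by norm_num) (by norm_num) 0 _ (clsPt 10 [1, 6]) (by decide)).trans
      (srwI_seed_encl_d10_v100001 1 (by norm_num) (by norm_num)).2
  · exact (absMonotone_srwI (d := 10) (n := 1) (by norm_num) (by norm_num) 0 _ (clsPt 10 [1, 6]) (by decide)).trans
      (srwI_seed_encl_d10_v100001 1 (by norm_num) (by norm_num)).2
  · exact (absMonotone_srwI (d := 10) (n := 1) (by norm_num) (by norm_num) 0 _ (clsPt 10 [1, 1, 6, 6]) (by decide)).trans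
      (srwI_seed_encl_d10_v200002 1 (by norm_num) (by norm_num)).2
  · exact (absMonotone_srwI (d := 10) (n := 1) (by norm_num) (by norm_num) 0 _ (clsPt 10 [1, 1, 6, 6]) (by decide)).trans
      (srwI_seed_encl_d10_v200002 1 (by norm_num) (by norm_num)).2
  · exact (absMonotone_srwI (d := 10) (n := 1) (by norm_num) (by norm_num) 0 _ (clsPt 10 [1, 1, 6, 6]) (by decide)).trans
      (srwI_seed_encl_d10_v200002 1 (by norm_num) (by norm_num)).2
  · exact (absMonotone_srwI (d := 10) (n := 1) (by norm_num) (by norm_num) 0 _ (clsPt 10 [1, 1, 6, 6]) (by decide)).trans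
      (srwI_seed_encl_d10_v200002 1 (by norm_num) (by norm_num)).2
  · exact (absMonotone_srwI (d := 10) (n := 1) (by norm_num) (by norm_num) 0 _ (clsPt 10 [1, 1, 6, 6]) (by decide)).trans
      (srwI_seed_encl_d10_v200002 1 (by norm_num) (by norm_num)).2
  · exact (absMonotone_srwI (d := 10) (n := 1) (by norm_num) (by norm_num) 0 _ (clsPt 10 [1, 1, 6, 6]) (by decide)).trans
      (srwI_seed_encl_d10_v200002 1 (by norm_num) (by norm_num)).2
  · exact (absMonotone_srwI (d := 10) (n := 1) (by norm_num) (by norm_num) 0 _ (clsPt 10 [1, 1, 6, 6]) (by decide)).trans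
      (srwI_seed_encl_d10_v200002 1 (by norm_num) (by norm_num)).2

/-- The two-level seeds at `M = 6`, order `2`: `I_{2,0}(6(e_0+…+e_k); 10) ≤ farI 2 k` by coordinatewise
domination (`absMonotone_srwI`) from the decided classes `[6]`, `[1,6]`, `[1,1,6,6]`. [cite: FitznerVanDerHofstad2016NoBLE, (5.1) p. 1090] -/
private theorem hIk_n2 : ∀ k ∈ Finset.range 10,
    srwI 10 2 0 (fun μ : Fin 10 => if (μ : ℕ) < k + 1 then ((6 : ℕ) : ℤ) else 0) ≤ ((farI 2 k : ℚ) : ℝ) := by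
  intro k hk
  rw [Finset.mem_range] at hk
  interval_cases k
  · exact (absMonotone_srwI (d := 10) (n := 2) (by norm_num) (by norm_num) 0 _ (clsPt 10 [6]) (by decide)).trans
      (srwI_seed_encl_d10_v000001 2 (by norm_num) (by norm_num)).2
  · exact (absMonotone_srwI (d := 10) (n := 2) (by norm_num) (by norm_num) 0 _ (clsPt 10 [1, 6]) (by decide)).trans
      (srwI_seed_encl_d10_v100001 2 (by norm_num) (by norm_num)).2
  · exact (absMonotone_srwI (d := 10) (n := 2) (by norm_num) (by norm_num) 0 _ (clsPt 10 [1, 6]) (by decide)).trans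
      (srwI_seed_encl_d10_v100001 2 (by norm_num) (by norm_num)).2
  · exact (absMonotone_srwI (d := 10) (n := 2) (by norm_num) (by norm_num) 0 _ (clsPt 10 [1, 1, 6, 6]) (by decide)).trans
      (srwI_seed_encl_d10_v200002 2 (by norm_num) (by norm_num)).2
  · exact (absMonotone_srwI (d := 10) (n := 2) (by norm_num) (by norm_num) 0 _ (clsPt 10 [1, 1, 6, 6]) (by decide)).trans
      (srwI_seed_encl_d10_v200002 2 (by norm_num) (by norm_num)).2
  · exact (absMonotone_srwI (d := 10) (n := 2) (by norm_num) (by norm_num) 0 _ (clsPt 10 [1, 1, 6, 6]) (by decide)).trans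
      (srwI_seed_encl_d10_v200002 2 (by norm_num) (by norm_num)).2
  · exact (absMonotone_srwI (d := 10) (n := 2) (by norm_num) (by norm_num) 0 _ (clsPt 10 [1, 1, 6, 6]) (by decide)).trans
      (srwI_seed_encl_d10_v200002 2 (by norm_num) (by norm_num)).2
  · exact (absMonotone_srwI (d := 10) (n := 2) (by norm_num) (by norm_num) 0 _ (clsPt 10 [1, 1, 6, 6]) (by decide)).trans
      (srwI_seed_encl_d10_v200002 2 (by norm_num) (by norm_num)).2
  · exact (absMonotone_srwI (d := 10) (n := 2) (by norm_num) (by norm_num) 0 _ (clsPt 10 [1, 1, 6, 6]) (by decide)).trans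
      (srwI_seed_encl_d10_v200002 2 (by norm_num) (by norm_num)).2
  · exact (absMonotone_srwI (d := 10) (n := 2) (by norm_num) (by norm_num) 0 _ (clsPt 10 [1, 1, 6, 6]) (by decide)).trans
      (srwI_seed_encl_d10_v200002 2 (by norm_num) (by norm_num)).2

/-- The two-level seeds at `M = 6`, order `3`: `I_{3,0}(6(e_0+…+e_k); 10) ≤ farI 3 k` by coordinatewise
domination (`absMonotone_srwI`) from the decided classes `[6]`, `[1,6]`, `[1,1,6,6]`. [cite: FitznerVanDerHofstad2016NoBLE, (5.1) p. 1090] -/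
private theorem hIk_n3 : ∀ k ∈ Finset.range 10,
    srwI 10 3 0 (fun μ : Fin 10 => if (μ : ℕ) < k + 1 then ((6 : ℕ) : ℤ) else 0) ≤ ((farI 3 k : ℚ) : ℝ) := by
  intro k hk
  rw [Finset.mem_range] at hk
  interval_cases k
  · exact (absMonotone_srwI (d := 10) (n := 3) (by norm_num) (by norm_num) 0 _ (clsPt 10 [6]) (by decide)).trans
      (srwI_seed_encl_d10_v000001 3 (by norm_num) (by norm_num)).2
  · exact (absMonotone_srwI (d := 10) (n := 3) (by norm_num) (by norm_num) 0 _ (clsPt 10 [1, 6]) (by decide)).trans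
      (srwI_seed_encl_d10_v100001 3 (by norm_num) (by norm_num)).2
  · exact (absMonotone_srwI (d := 10) (n := 3) (by norm_num) (by norm_num) 0 _ (clsPt 10 [1, 6]) (by decide)).trans
      (srwI_seed_encl_d10_v100001 3 (by norm_num) (by norm_num)).2
  · exact (absMonotone_srwI (d := 10) (n := 3) (by norm_num) (by norm_num) 0 _ (clsPt 10 [1, 1, 6, 6]) (by decide)).trans
      (srwI_seed_encl_d10_v200002 3 (by norm_num) (by norm_num)).2
  · exact (absMonotone_srwI (d := 10) (n := 3) (by norm_num) (by norm_num) 0 _ (clsPt 10 [1, 1, 6, 6]) (by decide)).trans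
      (srwI_seed_encl_d10_v200002 3 (by norm_num) (by norm_num)).2
  · exact (absMonotone_srwI (d := 10) (n := 3) (by norm_num) (by norm_num) 0 _ (clsPt 10 [1, 1, 6, 6]) (by decide)).trans
      (srwI_seed_encl_d10_v200002 3 (by norm_num) (by norm_num)).2
  · exact (absMonotone_srwI (d := 10) (n := 3) (by norm_num) (by norm_num) 0 _ (clsPt 10 [1, 1, 6, 6]) (by decide)).trans
      (srwI_seed_encl_d10_v200002 3 (by norm_num) (by norm_num)).2
  · exact (absMonotone_srwI (d := 10) (n := 3) (by norm_num) (by norm_num) 0 _ (clsPt 10 [1, 1, 6, 6]) (by decide)).trans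
      (srwI_seed_encl_d10_v200002 3 (by norm_num) (by norm_num)).2
  · exact (absMonotone_srwI (d := 10) (n := 3) (by norm_num) (by norm_num) 0 _ (clsPt 10 [1, 1, 6, 6]) (by decide)).trans
      (srwI_seed_encl_d10_v200002 3 (by norm_num) (by norm_num)).2
  · exact (absMonotone_srwI (d := 10) (n := 3) (by norm_num) (by norm_num) 0 _ (clsPt 10 [1, 1, 6, 6]) (by decide)).trans
      (srwI_seed_encl_d10_v200002 3 (by norm_num) (by norm_num)).2

/-! ### §4. The far twisted rows `|Tw_N(m e_0; β_r) − q_r^{10} I_{N,0}(0)| ≤ farEB‹β_r› N`, all `|m| ≥ 6` -/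

/-- **`|Tw_1(m e_0; 5) − q^{10} · I_{1,0}(0)| ≤ farEB05 1`** for EVERY `|m| ≥ 6` (`d = 10`, `q = qB05`).
[cite: FitznerVanDerHofstad2016NoBLE, §5.1.1 (5.2)–(5.5) pp. 1089–1090; DLMF, §10.2.2] -/
theorem srwTwist_far_d10_n1_b05 (m : ℤ) (hm : 6 ≤ m.natAbs) :
    |srwTwist 10 1 (fun _ => (1 : ℝ)) (Pi.single (0 : Fin 10) m) 5 - ((qB05 ^ 10 : ℚ) : ℝ) * srwI 10 1 0 0|
      ≤ ((farEB05 1 : ℚ) : ℝ) := by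
  have hm0 : m ≠ 0 := by
    rintro rfl
    simp at hm
  have h := abs_srwTwist_sub_lit_pow_mul_srwI_le_of_lit_main_cast (d := 10) 0 (by norm_num) (0 : Fin 10) hm0
    (5 : ℝ) 6 hm hq_b05 hdelta_b05 hIk_n1 (ITableD10.srwI_tab_encl_d10_origin 1 (by norm_num) 0 (by norm_num)).2
  rw [← Rat.cast_pow] at h
  exact h

/-- **`|Tw_1(m e_0; 10) − q^{10} · I_{1,0}(0)| ≤ farEB10 1`** for EVERY `|m| ≥ 6` (`d = 10`, `q = qB10`).
[cite: FitznerVanDerHofstad2016NoBLE, §5.1.1 (5.2)–(5.5) pp. 1089–1090; DLMF, §10.2.2] -/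
theorem srwTwist_far_d10_n1_b10 (m : ℤ) (hm : 6 ≤ m.natAbs) :
    |srwTwist 10 1 (fun _ => (1 : ℝ)) (Pi.single (0 : Fin 10) m) 10 - ((qB10 ^ 10 : ℚ) : ℝ) * srwI 10 1 0 0|
      ≤ ((farEB10 1 : ℚ) : ℝ) := by
  have hm0 : m ≠ 0 := by
    rintro rfl
    simp at hm
  have h := abs_srwTwist_sub_lit_pow_mul_srwI_le_of_lit_main_cast (d := 10) 0 (by norm_num) (0 : Fin 10) hm0
    (10 : ℝ) 6 hm hq_b10 hdelta_b10 hIk_n1 (ITableD10.srwI_tab_encl_d10_origin 1 (by norm_num) 0 (by norm_num)).2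
  rw [← Rat.cast_pow] at h
  exact h

/-- **`|Tw_1(m e_0; 15) − q^{10} · I_{1,0}(0)| ≤ farEB15 1`** for EVERY `|m| ≥ 6` (`d = 10`, `q = qB15`).
[cite: FitznerVanDerHofstad2016NoBLE, §5.1.1 (5.2)–(5.5) pp. 1089–1090; DLMF, §10.2.2] -/
theorem srwTwist_far_d10_n1_b15 (m : ℤ) (hm : 6 ≤ m.natAbs) :
    |srwTwist 10 1 (fun _ => (1 : ℝ)) (Pi.single (0 : Fin 10) m) 15 - ((qB15 ^ 10 : ℚ) : ℝ) * srwI 10 1 0 0|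
      ≤ ((farEB15 1 : ℚ) : ℝ) := by
  have hm0 : m ≠ 0 := by
    rintro rfl
    simp at hm
  have h := abs_srwTwist_sub_lit_pow_mul_srwI_le_of_lit_main_cast (d := 10) 0 (by norm_num) (0 : Fin 10) hm0
    (15 : ℝ) 6 hm hq_b15 hdelta_b15 hIk_n1 (ITableD10.srwI_tab_encl_d10_origin 1 (by norm_num) 0 (by norm_num)).2
  rw [← Rat.cast_pow] at h
  exact h

/-- **`|Tw_1(m e_0; 20) − q^{10} · I_{1,0}(0)| ≤ farEB20 1`** for EVERY `|m| ≥ 6` (`d = 10`, `q = qB20`).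
[cite: FitznerVanDerHofstad2016NoBLE, §5.1.1 (5.2)–(5.5) pp. 1089–1090; DLMF, §10.2.2] -/
theorem srwTwist_far_d10_n1_b20 (m : ℤ) (hm : 6 ≤ m.natAbs) :
    |srwTwist 10 1 (fun _ => (1 : ℝ)) (Pi.single (0 : Fin 10) m) 20 - ((qB20 ^ 10 : ℚ) : ℝ) * srwI 10 1 0 0|
      ≤ ((farEB20 1 : ℚ) : ℝ) := by
  have hm0 : m ≠ 0 := by
    rintro rfl
    simp at hm
  have h := abs_srwTwist_sub_lit_pow_mul_srwI_le_of_lit_main_cast (d := 10) 0 (by norm_num) (0 : Fin 10) hm0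
    (20 : ℝ) 6 hm hq_b20 hdelta_b20 hIk_n1 (ITableD10.srwI_tab_encl_d10_origin 1 (by norm_num) 0 (by norm_num)).2
  rw [← Rat.cast_pow] at h
  exact h

/-- **`|Tw_1(m e_0; 25) − q^{10} · I_{1,0}(0)| ≤ farEB25 1`** for EVERY `|m| ≥ 6` (`d = 10`, `q = qB25`).
[cite: FitznerVanDerHofstad2016NoBLE, §5.1.1 (5.2)–(5.5) pp. 1089–1090; DLMF, §10.2.2] -/
theorem srwTwist_far_d10_n1_b25 (m : ℤ) (hm : 6 ≤ m.natAbs) :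
    |srwTwist 10 1 (fun _ => (1 : ℝ)) (Pi.single (0 : Fin 10) m) 25 - ((qB25 ^ 10 : ℚ) : ℝ) * srwI 10 1 0 0|
      ≤ ((farEB25 1 : ℚ) : ℝ) := by
  have hm0 : m ≠ 0 := by
    rintro rfl
    simp at hm
  have h := abs_srwTwist_sub_lit_pow_mul_srwI_le_of_lit_main_cast (d := 10) 0 (by norm_num) (0 : Fin 10) hm0
    (25 : ℝ) 6 hm hq_b25 hdelta_b25 hIk_n1 (ITableD10.srwI_tab_encl_d10_origin 1 (by norm_num) 0 (by norm_num)).2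
  rw [← Rat.cast_pow] at h
  exact h

/-- **`|Tw_1(m e_0; 30) − q^{10} · I_{1,0}(0)| ≤ farEB30 1`** for EVERY `|m| ≥ 6` (`d = 10`, `q = qB30`).
[cite: FitznerVanDerHofstad2016NoBLE, §5.1.1 (5.2)–(5.5) pp. 1089–1090; DLMF, §10.2.2] -/
theorem srwTwist_far_d10_n1_b30 (m : ℤ) (hm : 6 ≤ m.natAbs) :
    |srwTwist 10 1 (fun _ => (1 : ℝ)) (Pi.single (0 : Fin 10) m) 30 - ((qB30 ^ 10 : ℚ) : ℝ) * srwI 10 1 0 0|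
      ≤ ((farEB30 1 : ℚ) : ℝ) := by
  have hm0 : m ≠ 0 := by
    rintro rfl
    simp at hm
  have h := abs_srwTwist_sub_lit_pow_mul_srwI_le_of_lit_main_cast (d := 10) 0 (by norm_num) (0 : Fin 10) hm0
    (30 : ℝ) 6 hm hq_b30 hdelta_b30 hIk_n1 (ITableD10.srwI_tab_encl_d10_origin 1 (by norm_num) 0 (by norm_num)).2
  rw [← Rat.cast_pow] at h
  exact h

/-- **`|Tw_2(m e_0; 5) − q^{10} · I_{2,0}(0)| ≤ farEB05 2`** for EVERY `|m| ≥ 6` (`d = 10`, `q = qB05`).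
[cite: FitznerVanDerHofstad2016NoBLE, §5.1.1 (5.2)–(5.5) pp. 1089–1090; DLMF, §10.2.2] -/
theorem srwTwist_far_d10_n2_b05 (m : ℤ) (hm : 6 ≤ m.natAbs) :
    |srwTwist 10 2 (fun _ => (1 : ℝ)) (Pi.single (0 : Fin 10) m) 5 - ((qB05 ^ 10 : ℚ) : ℝ) * srwI 10 2 0 0|
      ≤ ((farEB05 2 : ℚ) : ℝ) := by
  have hm0 : m ≠ 0 := by
    rintro rfl
    simp at hm
  have h := abs_srwTwist_sub_lit_pow_mul_srwI_le_of_lit_main_cast (d := 10) 1 (by norm_num) (0 : Fin 10) hm0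
    (5 : ℝ) 6 hm hq_b05 hdelta_b05 hIk_n2 (ITableD10.srwI_tab_encl_d10_origin 2 (by norm_num) 0 (by norm_num)).2
  rw [← Rat.cast_pow] at h
  exact h

/-- **`|Tw_2(m e_0; 10) − q^{10} · I_{2,0}(0)| ≤ farEB10 2`** for EVERY `|m| ≥ 6` (`d = 10`, `q = qB10`).
[cite: FitznerVanDerHofstad2016NoBLE, §5.1.1 (5.2)–(5.5) pp. 1089–1090; DLMF, §10.2.2] -/
theorem srwTwist_far_d10_n2_b10 (m : ℤ) (hm : 6 ≤ m.natAbs) :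
    |srwTwist 10 2 (fun _ => (1 : ℝ)) (Pi.single (0 : Fin 10) m) 10 - ((qB10 ^ 10 : ℚ) : ℝ) * srwI 10 2 0 0|
      ≤ ((farEB10 2 : ℚ) : ℝ) := by
  have hm0 : m ≠ 0 := by
    rintro rfl
    simp at hm
  have h := abs_srwTwist_sub_lit_pow_mul_srwI_le_of_lit_main_cast (d := 10) 1 (by norm_num) (0 : Fin 10) hm0
    (10 : ℝ) 6 hm hq_b10 hdelta_b10 hIk_n2 (ITableD10.srwI_tab_encl_d10_origin 2 (by norm_num) 0 (by norm_num)).2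
  rw [← Rat.cast_pow] at h
  exact h

/-- **`|Tw_2(m e_0; 15) − q^{10} · I_{2,0}(0)| ≤ farEB15 2`** for EVERY `|m| ≥ 6` (`d = 10`, `q = qB15`).
[cite: FitznerVanDerHofstad2016NoBLE, §5.1.1 (5.2)–(5.5) pp. 1089–1090; DLMF, §10.2.2] -/
theorem srwTwist_far_d10_n2_b15 (m : ℤ) (hm : 6 ≤ m.natAbs) :
    |srwTwist 10 2 (fun _ => (1 : ℝ)) (Pi.single (0 : Fin 10) m) 15 - ((qB15 ^ 10 : ℚ) : ℝ) * srwI 10 2 0 0|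
      ≤ ((farEB15 2 : ℚ) : ℝ) := by
  have hm0 : m ≠ 0 := by
    rintro rfl
    simp at hm
  have h := abs_srwTwist_sub_lit_pow_mul_srwI_le_of_lit_main_cast (d := 10) 1 (by norm_num) (0 : Fin 10) hm0
    (15 : ℝ) 6 hm hq_b15 hdelta_b15 hIk_n2 (ITableD10.srwI_tab_encl_d10_origin 2 (by norm_num) 0 (by norm_num)).2
  rw [← Rat.cast_pow] at h
  exact h

/-- **`|Tw_2(m e_0; 20) − q^{10} · I_{2,0}(0)| ≤ farEB20 2`** for EVERY `|m| ≥ 6` (`d = 10`, `q = qB20`).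
[cite: FitznerVanDerHofstad2016NoBLE, §5.1.1 (5.2)–(5.5) pp. 1089–1090; DLMF, §10.2.2] -/
theorem srwTwist_far_d10_n2_b20 (m : ℤ) (hm : 6 ≤ m.natAbs) :
    |srwTwist 10 2 (fun _ => (1 : ℝ)) (Pi.single (0 : Fin 10) m) 20 - ((qB20 ^ 10 : ℚ) : ℝ) * srwI 10 2 0 0|
      ≤ ((farEB20 2 : ℚ) : ℝ) := by
  have hm0 : m ≠ 0 := by
    rintro rfl
    simp at hm
  have h := abs_srwTwist_sub_lit_pow_mul_srwI_le_of_lit_main_cast (d := 10) 1 (by norm_num) (0 : Fin 10) hm0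
    (20 : ℝ) 6 hm hq_b20 hdelta_b20 hIk_n2 (ITableD10.srwI_tab_encl_d10_origin 2 (by norm_num) 0 (by norm_num)).2
  rw [← Rat.cast_pow] at h
  exact h

/-- **`|Tw_2(m e_0; 25) − q^{10} · I_{2,0}(0)| ≤ farEB25 2`** for EVERY `|m| ≥ 6` (`d = 10`, `q = qB25`).
[cite: FitznerVanDerHofstad2016NoBLE, §5.1.1 (5.2)–(5.5) pp. 1089–1090; DLMF, §10.2.2] -/
theorem srwTwist_far_d10_n2_b25 (m : ℤ) (hm : 6 ≤ m.natAbs) :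
    |srwTwist 10 2 (fun _ => (1 : ℝ)) (Pi.single (0 : Fin 10) m) 25 - ((qB25 ^ 10 : ℚ) : ℝ) * srwI 10 2 0 0|
      ≤ ((farEB25 2 : ℚ) : ℝ) := by
  have hm0 : m ≠ 0 := by
    rintro rfl
    simp at hm
  have h := abs_srwTwist_sub_lit_pow_mul_srwI_le_of_lit_main_cast (d := 10) 1 (by norm_num) (0 : Fin 10) hm0
    (25 : ℝ) 6 hm hq_b25 hdelta_b25 hIk_n2 (ITableD10.srwI_tab_encl_d10_origin 2 (by norm_num) 0 (by norm_num)).2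
  rw [← Rat.cast_pow] at h
  exact h

/-- **`|Tw_2(m e_0; 30) − q^{10} · I_{2,0}(0)| ≤ farEB30 2`** for EVERY `|m| ≥ 6` (`d = 10`, `q = qB30`).
[cite: FitznerVanDerHofstad2016NoBLE, §5.1.1 (5.2)–(5.5) pp. 1089–1090; DLMF, §10.2.2] -/
theorem srwTwist_far_d10_n2_b30 (m : ℤ) (hm : 6 ≤ m.natAbs) :
    |srwTwist 10 2 (fun _ => (1 : ℝ)) (Pi.single (0 : Fin 10) m) 30 - ((qB30 ^ 10 : ℚ) : ℝ) * srwI 10 2 0 0|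
      ≤ ((farEB30 2 : ℚ) : ℝ) := by
  have hm0 : m ≠ 0 := by
    rintro rfl
    simp at hm
  have h := abs_srwTwist_sub_lit_pow_mul_srwI_le_of_lit_main_cast (d := 10) 1 (by norm_num) (0 : Fin 10) hm0
    (30 : ℝ) 6 hm hq_b30 hdelta_b30 hIk_n2 (ITableD10.srwI_tab_encl_d10_origin 2 (by norm_num) 0 (by norm_num)).2
  rw [← Rat.cast_pow] at h
  exact h

/-- **`|Tw_3(m e_0; 5) − q^{10} · I_{3,0}(0)| ≤ farEB05 3`** for EVERY `|m| ≥ 6` (`d = 10`, `q = qB05`).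
[cite: FitznerVanDerHofstad2016NoBLE, §5.1.1 (5.2)–(5.5) pp. 1089–1090; DLMF, §10.2.2] -/
theorem srwTwist_far_d10_n3_b05 (m : ℤ) (hm : 6 ≤ m.natAbs) :
    |srwTwist 10 3 (fun _ => (1 : ℝ)) (Pi.single (0 : Fin 10) m) 5 - ((qB05 ^ 10 : ℚ) : ℝ) * srwI 10 3 0 0|
      ≤ ((farEB05 3 : ℚ) : ℝ) := by
  have hm0 : m ≠ 0 := by
    rintro rfl
    simp at hm
  have h := abs_srwTwist_sub_lit_pow_mul_srwI_le_of_lit_main_cast (d := 10) 2 (by norm_num) (0 : Fin 10) hm0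
    (5 : ℝ) 6 hm hq_b05 hdelta_b05 hIk_n3 (ITableD10.srwI_tab_encl_d10_origin 3 (by norm_num) 0 (by norm_num)).2
  rw [← Rat.cast_pow] at h
  exact h

/-- **`|Tw_3(m e_0; 10) − q^{10} · I_{3,0}(0)| ≤ farEB10 3`** for EVERY `|m| ≥ 6` (`d = 10`, `q = qB10`).
[cite: FitznerVanDerHofstad2016NoBLE, §5.1.1 (5.2)–(5.5) pp. 1089–1090; DLMF, §10.2.2] -/
theorem srwTwist_far_d10_n3_b10 (m : ℤ) (hm : 6 ≤ m.natAbs) :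
    |srwTwist 10 3 (fun _ => (1 : ℝ)) (Pi.single (0 : Fin 10) m) 10 - ((qB10 ^ 10 : ℚ) : ℝ) * srwI 10 3 0 0|
      ≤ ((farEB10 3 : ℚ) : ℝ) := by
  have hm0 : m ≠ 0 := by
    rintro rfl
    simp at hm
  have h := abs_srwTwist_sub_lit_pow_mul_srwI_le_of_lit_main_cast (d := 10) 2 (by norm_num) (0 : Fin 10) hm0
    (10 : ℝ) 6 hm hq_b10 hdelta_b10 hIk_n3 (ITableD10.srwI_tab_encl_d10_origin 3 (by norm_num) 0 (by norm_num)).2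
  rw [← Rat.cast_pow] at h
  exact h

/-- **`|Tw_3(m e_0; 15) − q^{10} · I_{3,0}(0)| ≤ farEB15 3`** for EVERY `|m| ≥ 6` (`d = 10`, `q = qB15`).
[cite: FitznerVanDerHofstad2016NoBLE, §5.1.1 (5.2)–(5.5) pp. 1089–1090; DLMF, §10.2.2] -/
theorem srwTwist_far_d10_n3_b15 (m : ℤ) (hm : 6 ≤ m.natAbs) :
    |srwTwist 10 3 (fun _ => (1 : ℝ)) (Pi.single (0 : Fin 10) m) 15 - ((qB15 ^ 10 : ℚ) : ℝ) * srwI 10 3 0 0|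
      ≤ ((farEB15 3 : ℚ) : ℝ) := by
  have hm0 : m ≠ 0 := by
    rintro rfl
    simp at hm
  have h := abs_srwTwist_sub_lit_pow_mul_srwI_le_of_lit_main_cast (d := 10) 2 (by norm_num) (0 : Fin 10) hm0
    (15 : ℝ) 6 hm hq_b15 hdelta_b15 hIk_n3 (ITableD10.srwI_tab_encl_d10_origin 3 (by norm_num) 0 (by norm_num)).2
  rw [← Rat.cast_pow] at h
  exact h

/-- **`|Tw_3(m e_0; 20) − q^{10} · I_{3,0}(0)| ≤ farEB20 3`** for EVERY `|m| ≥ 6` (`d = 10`, `q = qB20`).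
[cite: FitznerVanDerHofstad2016NoBLE, §5.1.1 (5.2)–(5.5) pp. 1089–1090; DLMF, §10.2.2] -/
theorem srwTwist_far_d10_n3_b20 (m : ℤ) (hm : 6 ≤ m.natAbs) :
    |srwTwist 10 3 (fun _ => (1 : ℝ)) (Pi.single (0 : Fin 10) m) 20 - ((qB20 ^ 10 : ℚ) : ℝ) * srwI 10 3 0 0|
      ≤ ((farEB20 3 : ℚ) : ℝ) := by
  have hm0 : m ≠ 0 := by
    rintro rfl
    simp at hm
  have h := abs_srwTwist_sub_lit_pow_mul_srwI_le_of_lit_main_cast (d := 10) 2 (by norm_num) (0 : Fin 10) hm0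
    (20 : ℝ) 6 hm hq_b20 hdelta_b20 hIk_n3 (ITableD10.srwI_tab_encl_d10_origin 3 (by norm_num) 0 (by norm_num)).2
  rw [← Rat.cast_pow] at h
  exact h

/-- **`|Tw_3(m e_0; 25) − q^{10} · I_{3,0}(0)| ≤ farEB25 3`** for EVERY `|m| ≥ 6` (`d = 10`, `q = qB25`).
[cite: FitznerVanDerHofstad2016NoBLE, §5.1.1 (5.2)–(5.5) pp. 1089–1090; DLMF, §10.2.2] -/
theorem srwTwist_far_d10_n3_b25 (m : ℤ) (hm : 6 ≤ m.natAbs) :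
    |srwTwist 10 3 (fun _ => (1 : ℝ)) (Pi.single (0 : Fin 10) m) 25 - ((qB25 ^ 10 : ℚ) : ℝ) * srwI 10 3 0 0|
      ≤ ((farEB25 3 : ℚ) : ℝ) := by
  have hm0 : m ≠ 0 := by
    rintro rfl
    simp at hm
  have h := abs_srwTwist_sub_lit_pow_mul_srwI_le_of_lit_main_cast (d := 10) 2 (by norm_num) (0 : Fin 10) hm0
    (25 : ℝ) 6 hm hq_b25 hdelta_b25 hIk_n3 (ITableD10.srwI_tab_encl_d10_origin 3 (by norm_num) 0 (by norm_num)).2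
  rw [← Rat.cast_pow] at h
  exact h

/-- **`|Tw_3(m e_0; 30) − q^{10} · I_{3,0}(0)| ≤ farEB30 3`** for EVERY `|m| ≥ 6` (`d = 10`, `q = qB30`).
[cite: FitznerVanDerHofstad2016NoBLE, §5.1.1 (5.2)–(5.5) pp. 1089–1090; DLMF, §10.2.2] -/
theorem srwTwist_far_d10_n3_b30 (m : ℤ) (hm : 6 ≤ m.natAbs) :
    |srwTwist 10 3 (fun _ => (1 : ℝ)) (Pi.single (0 : Fin 10) m) 30 - ((qB30 ^ 10 : ℚ) : ℝ) * srwI 10 3 0 0|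
      ≤ ((farEB30 3 : ℚ) : ℝ) := by
  have hm0 : m ≠ 0 := by
    rintro rfl
    simp at hm
  have h := abs_srwTwist_sub_lit_pow_mul_srwI_le_of_lit_main_cast (d := 10) 2 (by norm_num) (0 : Fin 10) hm0
    (30 : ℝ) 6 hm hq_b30 hdelta_b30 hIk_n3 (ITableD10.srwI_tab_encl_d10_origin 3 (by norm_num) 0 (by norm_num)).2
  rw [← Rat.cast_pow] at h
  exact h

/-! ### §5. The m-uniform `K_{N,0}` far axis rows -/

/-- Six one-sided literal bounds at `β = 5, …, 30` in the `∀ r : Fin 6` shape of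
`srwK_zero_single_le_uniform_gset_cast`. [folklore] -/
private theorem abs_forall_gsetB {G : ℝ → ℝ} {S : ℝ} {c₀ c₁ c₂ c₃ c₄ c₅ e₀ e₁ e₂ e₃ e₄ e₅ : ℚ}
    (h0 : |G 5 - (c₀ : ℝ) * S| ≤ (e₀ : ℝ)) (h1 : |G 10 - (c₁ : ℝ) * S| ≤ (e₁ : ℝ))
    (h2 : |G 15 - (c₂ : ℝ) * S| ≤ (e₂ : ℝ)) (h3 : |G 20 - (c₃ : ℝ) * S| ≤ (e₃ : ℝ))
    (h4 : |G 25 - (c₄ : ℝ) * S| ≤ (e₄ : ℝ)) (h5 : |G 30 - (c₅ : ℝ) * S| ≤ (e₅ : ℝ)) :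
    ∀ r : Fin 6, |G (gsetB r) - ((![c₀, c₁, c₂, c₃, c₄, c₅] r : ℚ) : ℝ) * S|
      ≤ ((![e₀, e₁, e₂, e₃, e₄, e₅] r : ℚ) : ℝ) := by
  intro r
  fin_cases r
  · simpa [gsetB, MajCert.gset] using h0
  · simpa [gsetB, MajCert.gset] using h1
  · simpa [gsetB, MajCert.gset] using h2
  · simpa [gsetB, MajCert.gset] using h3
  · simpa [gsetB, MajCert.gset] using h4
  · simpa [gsetB, MajCert.gset] using h5

/-- [folklore] -/
private theorem ax01 : (0 : Fin 10) ≠ 1 := by decide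

/-- `[6]` is dominated coordinatewise by `12 e_0`. [folklore] -/
private theorem dom_two : ∀ μ : Fin 10,
    |clsPt 10 [6] μ| ≤ |(Pi.single (0 : Fin 10) (2 * ((6 : ℕ) : ℤ)) : Fin 10 → ℤ) μ| := by decide

/-- `[1,6]` is dominated coordinatewise by `6 e_0 + 6 e_1`. [folklore] -/
private theorem dom_pair : ∀ μ : Fin 10,
    |clsPt 10 [1, 6] μ| ≤ |(Pi.single (0 : Fin 10) ((6 : ℕ) : ℤ) + Pi.single (1 : Fin 10) ((6 : ℕ) : ℤ) : Fin 10 → ℤ) μ| := by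
  decide

/-- **`K_{1,0}(m e_i; 10) ≤ 194492 / 10⁶` for EVERY `|m| ≥ 6`** and every axis `i` (the m-uniform far row,
`M = 6`). [cite: FitznerVanDerHofstad2016NoBLE, (5.15) p. 1092, §5.1.1 (5.2)–(5.5) pp. 1089–1090] -/
theorem srwK_zero_far_d10_n1 (i : Fin 10) (m : ℤ) (hm : 6 ≤ m.natAbs) :
    srwK 10 1 0 (Pi.single i m) ≤ ((194492 / 1000000 : ℚ) : ℝ) := by
  rw [apply_single_eq_of_spInvariant (F := srwK 10 1 0) (fun τ x => srwK_spAct 1 0 τ x) i 0 m]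
  exact (srwK_zero_single_le_uniform_gset_cast (d := 10) (n := 1) (by norm_num) (by norm_num) ax01 6 hm
    (ITableD10.srwI_tab_encl_d10_origin 1 (by norm_num) 0 (by norm_num))
    ((absMonotone_srwI (d := 10) (n := 1) (by norm_num) (by norm_num) 0 _ _ dom_two).trans
      (srwI_seed_encl_d10_v000001 1 (by norm_num) (by norm_num)).2)
    ((absMonotone_srwI (d := 10) (n := 1) (by norm_num) (by norm_num) 0 _ _ dom_pair).trans
      (srwI_seed_encl_d10_v100001 1 (by norm_num) (by norm_num)).2)
    (abs_forall_gsetB (srwTwist_far_d10_n1_b05 m hm) (srwTwist_far_d10_n1_b10 m hm) (srwTwist_far_d10_n1_b15 m hm) (srwTwist_far_d10_n1_b20 m hm) (srwTwist_far_d10_n1_b25 m hm) (srwTwist_far_d10_n1_b30 m hm))).trans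
    (Rat.cast_le.mpr (by decide +kernel))

/-- **`K_{2,0}(m e_i; 10) ≤ 221423 / 10⁶` for EVERY `|m| ≥ 6`** and every axis `i` (the m-uniform far row,
`M = 6`). [cite: FitznerVanDerHofstad2016NoBLE, (5.15) p. 1092, §5.1.1 (5.2)–(5.5) pp. 1089–1090] -/
theorem srwK_zero_far_d10_n2 (i : Fin 10) (m : ℤ) (hm : 6 ≤ m.natAbs) :
    srwK 10 2 0 (Pi.single i m) ≤ ((221423 / 1000000 : ℚ) : ℝ) := by
  rw [apply_single_eq_of_spInvariant (F := srwK 10 2 0) (fun τ x => srwK_spAct 2 0 τ x) i 0 m]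
  exact (srwK_zero_single_le_uniform_gset_cast (d := 10) (n := 2) (by norm_num) (by norm_num) ax01 6 hm
    (ITableD10.srwI_tab_encl_d10_origin 2 (by norm_num) 0 (by norm_num))
    ((absMonotone_srwI (d := 10) (n := 2) (by norm_num) (by norm_num) 0 _ _ dom_two).trans
      (srwI_seed_encl_d10_v000001 2 (by norm_num) (by norm_num)).2)
    ((absMonotone_srwI (d := 10) (n := 2) (by norm_num) (by norm_num) 0 _ _ dom_pair).trans
      (srwI_seed_encl_d10_v100001 2 (by norm_num) (by norm_num)).2)
    (abs_forall_gsetB (srwTwist_far_d10_n2_b05 m hm) (srwTwist_far_d10_n2_b10 m hm) (srwTwist_far_d10_n2_b15 m hm) (srwTwist_far_d10_n2_b20 m hm) (srwTwist_far_d10_n2_b25 m hm) (srwTwist_far_d10_n2_b30 m hm))).trans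
    (Rat.cast_le.mpr (by decide +kernel))

/-- **`K_{3,0}(m e_i; 10) ≤ 286086 / 10⁶` for EVERY `|m| ≥ 6`** and every axis `i` (the m-uniform far row,
`M = 6`). [cite: FitznerVanDerHofstad2016NoBLE, (5.15) p. 1092, §5.1.1 (5.2)–(5.5) pp. 1089–1090] -/
theorem srwK_zero_far_d10_n3 (i : Fin 10) (m : ℤ) (hm : 6 ≤ m.natAbs) :
    srwK 10 3 0 (Pi.single i m) ≤ ((286086 / 1000000 : ℚ) : ℝ) := by
  rw [apply_single_eq_of_spInvariant (F := srwK 10 3 0) (fun τ x => srwK_spAct 3 0 τ x) i 0 m]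
  exact (srwK_zero_single_le_uniform_gset_cast (d := 10) (n := 3) (by norm_num) (by norm_num) ax01 6 hm
    (ITableD10.srwI_tab_encl_d10_origin 3 (by norm_num) 0 (by norm_num))
    ((absMonotone_srwI (d := 10) (n := 3) (by norm_num) (by norm_num) 0 _ _ dom_two).trans
      (srwI_seed_encl_d10_v000001 3 (by norm_num) (by norm_num)).2)
    ((absMonotone_srwI (d := 10) (n := 3) (by norm_num) (by norm_num) 0 _ _ dom_pair).trans
      (srwI_seed_encl_d10_v100001 3 (by norm_num) (by norm_num)).2)
    (abs_forall_gsetB (srwTwist_far_d10_n3_b05 m hm) (srwTwist_far_d10_n3_b10 m hm) (srwTwist_far_d10_n3_b15 m hm) (srwTwist_far_d10_n3_b20 m hm) (srwTwist_far_d10_n3_b25 m hm) (srwTwist_far_d10_n3_b30 m hm))).trans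
    (Rat.cast_le.mpr (by decide +kernel))

end FarRowD10

end Literature.Probability.FitznerVanDerHofstad2017
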